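import Summits.QuantumAdvantage.AdviceFreeQNC0.ViolaFenceAveraging
import Literature.Probability.Moments.HoeffdingCounting
import HarnessLib

/-!
# Cell qa-qnc0 (rung F-Q1, route RingFrame, crux α): FENCE F9-V in the kernel —
# `violaFence_of_violaXor : ViolaXorLemma → ViolaFence` (planner qa-qnc0-p2 ROUND-9/10, ask P-10V)

`ViolaFence` (`CertificateTransfer.lean`, Sketch9p2 verbatim): for `δ, ε, η ∈ (0, 1/4)` and
`s + ⌈log₂ s⌉ + ⌈log₂⌈1/δ⌉⌉ + 8 ≤ D` there is NO row certificate `RowCert M D s δ ε η` for large `M`.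
Here it is DERIVED from the Literature fact `SmallBiasXor.ViolaXorLemma` (Viola 2009, Thm 2), following
planner p2's Sketch10 with two simplifications (no `d`-th roots: per-summand noise rate `δ/(2d)`; tails by
exponential moments instead of Chebyshev / ball counting):

* `d := oddUp s` (odd, `s ≤ d ≤ s+1`), `Y := unifOn 𝓕_M(D) ⊕ Ber(δ/(2d))` is `ε'`-biased,
  `ε' = (1 − δ/d)^{2^{D+1}}` — parities of weight `< 2^{D+1}` are balanced on the fail coset
  (`parityBias_failSetW_eq_zero`, `FailFamilyDual.lean`), heavier ones are damped (`parityBias_ber`);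
* the XOR of `d` copies of `Y` has law `unifOn 𝓕 ⊕ Ber(q)`, `q = (1 − (1−δ/d)^d)/2 ≤ δ/2` (`foldLaw`,
  `CubeDistributions.lean`; Bernoulli's inequality);
* under it a row is `δ`-close to `𝓕` except with mass `≤ (1+q)^N/2^{⌊δN⌋+1} → 0` (`massNotClose_le`,
  Markov on `2^{|noise|}`); under the uniform distribution a row is `ε`-far except with mass
  `≤ 4^{ι(M,D)}·e^{−N/8} → 0` (`massNotFar_le`: the tree's counting Hoeffding inequality
  `hoeffding_count_pi` for the Hamming ball, times `|𝓕_M(D)| ≤ 4^{ι(M,D)}`);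
* AVERAGING over a certificate family (`averaging`): some member `Φ` has
  `polyBias_close(Φ) − polyBias_unif(Φ) ≥ 2(1 − 2η − 1/8 − 1/8) > 1/2`, while Viola's theorem (degree
  `s ≤ d`) bounds the difference by `16·ε'^{1/2^{d−1}} = 16(1 − δ/d)^{2^{D+2−d}} ≤ 1/2` under the degree
  hypothesis (`viola_error_le_half`).  Contradiction.

So the certificate paradigm's books are closed in the kernel on the lower side: α ⟸ `RowCertPoly`
(`ringHard_two_of_rowCertPoly`) and NO certificates below degree `D − O(log(D/δ))` given Viola's theorem.
WHAT THIS IS NOT: `ViolaXorLemma` itself is a cited FACT (not proved here), so `ViolaFence` is landed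
CONDITIONALLY on it; nothing on α; the paradigm is PARKED (ROUND-10); separation NOT moved.
-/

noncomputable section

namespace Summit.QuantumAdvantage.AdviceFreeQNC0

namespace CubeDistr

open Finset
open Literature.Computability.Complexity.SmallBiasXor
open Literature.Computability.MetaComplexity Literature.Computability.MetaComplexity.Smolensky
open Literature.Probability.Moments

variable {M : ℕ}

/-! ### The far tail: uniform rows are `ε`-far (Sketch10 `L6`, by Hoeffding counting) -/

/-- **Hamming ball bound** (`ε ≤ 1/4`): `#{W : |W| < εN} ≤ e^{−N/8}·2^N`, from the tree's counting Hoeffding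
inequality. -/
theorem card_ball_le {N : ℕ} (hN : 0 < N) {ε : ℝ} (hε : ε ≤ 1 / 4) :
    ((univ.filter fun W : Fin N → Bool => (hw W : ℝ) < ε * N).card : ℝ) ≤
      Real.exp (-((N : ℝ) / 8)) * (2 : ℝ) ^ N := by
  classical
  have hH := hoeffding_count_pi (ι := Fin N) (κ := fun _ => Bool)
    (fun _ b => if b = true then (-1 / 2 : ℝ) else 1 / 2) (fun _ => 1 / 2)
    (by intro i; rw [Fintype.sum_bool]; norm_num)
    (by intro i b; cases b <;> norm_num [abs_of_nonneg, abs_of_nonpos])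
    (t := (N : ℝ) / 4) (by positivity)
    (by rw [Finset.sum_const, Finset.card_univ, Fintype.card_fin, nsmul_eq_mul]; positivity)
  have hsum : ∀ W : Fin N → Bool, (∑ i, (if W i = true then (-1 / 2 : ℝ) else 1 / 2)) = (N : ℝ) / 2 - hw W := by
    intro W
    have h : ∀ i, (if W i = true then (-1 / 2 : ℝ) else 1 / 2) = 1 / 2 - (if W i = true then (1 : ℝ) else 0) := by
      intro i; split_ifs <;> norm_num
    rw [Finset.sum_congr rfl fun i _ => h i, Finset.sum_sub_distrib, Finset.sum_const, Finset.card_univ,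
      Fintype.card_fin, nsmul_eq_mul]
    unfold hw
    rw [Finset.natCast_card_filter]
    ring
  refine le_trans ?_ (le_trans hH (le_of_eq ?_))
  · refine Nat.cast_le.2 (Finset.card_le_card fun W hW => ?_)
    rw [Finset.mem_filter] at hW ⊢
    refine ⟨hW.1, ?_⟩
    rw [hsum W]
    have hN4 : ε * N ≤ (N : ℝ) / 4 := by nlinarith [(Nat.cast_pos.2 hN : (0 : ℝ) < N)]
    linarith [hW.2]
  · rw [Finset.sum_const, Finset.card_univ, Fintype.card_fin, nsmul_eq_mul, Finset.prod_const,
      Finset.card_univ, Fintype.card_fin, Fintype.card_bool]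
    push_cast
    congr 1
    congr 1
    have hN0 : (N : ℝ) ≠ 0 := by exact_mod_cast hN.ne'
    field_simp
    ring

/-- Distance to a fail pattern through the encoding. -/
theorem hw_bxor_ofRow (F : (Fin M → Bool) → Bool) (W : Fin (RN M) → Bool) :
    hw (bxor (ofRow F) W) = hdist (toRow W) F := by
  unfold hdist hw bxor ofRow toRow
  rw [← card_filter_enc (fun i : Fin (RN M) =>
    xor (F ((Fintype.equivFin (Fin M → Bool)).symm i)) (W i) = true)]
  congr 1
  ext v
  simp only [Finset.mem_filter, Finset.mem_univ, true_and, ne_eq, Equiv.symm_apply_apply]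
  cases F v <;> cases W (Fintype.equivFin (Fin M → Bool) v) <;> simp

/-- **Far tail**: under the uniform distribution the mass of rows at distance `< ε2^M` from `𝓕_M(D)` is at
most `|𝓕_M(D)|·e^{−N/8} ≤ 4^{ι(M,D)}·e^{−N/8}`. -/
theorem massNotFar_le {D : ℕ} {ε : ℝ} (hε : ε ≤ 1 / 4) :
    massNotFar M D ε (unifDistr (RN M)) ≤ (4 : ℝ) ^ monoCount M D * Real.exp (-(((RN M : ℕ) : ℝ) / 8)) := by
  classical
  have hNpos : 0 < RN M := by rw [RN_eq]; exact Nat.two_pow_pos M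
  have hN : ((RN M : ℕ) : ℝ) = (2 : ℝ) ^ M := RN_real M
  have h2N : (0 : ℝ) < (2 : ℝ) ^ RN M := by positivity
  set bad := univ.filter fun W : Fin (RN M) → Bool => (distFail D (toRow W) : ℝ) < ε * (2 : ℝ) ^ M with hbad
  -- the mass is `#bad / 2^N`
  have h1 : massNotFar M D ε (unifDistr (RN M)) = (bad.card : ℝ) / (2 : ℝ) ^ RN M := by
    unfold massNotFar unifDistr
    rw [← Finset.sum_filter, Finset.sum_const, nsmul_eq_mul]
    ring
  -- `bad` is covered by the Hamming balls around the fail patterns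
  have h2 : bad ⊆ (failSetW M D).biUnion
      fun V => univ.filter fun W : Fin (RN M) → Bool => (hw (bxor V W) : ℝ) < ε * (2 : ℝ) ^ M := by
    intro W hW
    rw [hbad, Finset.mem_filter] at hW
    obtain ⟨F, hF, hdF⟩ := exists_distFail_eq D (toRow W)
    rw [Finset.mem_biUnion]
    refine ⟨ofRow F, ofRow_mem_failSetW hF, Finset.mem_filter.2 ⟨Finset.mem_univ _, ?_⟩⟩
    rw [hw_bxor_ofRow, hdF]
    exact hW.2
  -- each ball has the cardinality of the ball at the origin
  have h3 : ∀ V : Fin (RN M) → Bool,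
      (univ.filter fun W : Fin (RN M) → Bool => (hw (bxor V W) : ℝ) < ε * (2 : ℝ) ^ M).card =
        (univ.filter fun W : Fin (RN M) → Bool => (hw W : ℝ) < ε * (2 : ℝ) ^ M).card := by
    intro V
    have h := Equiv.sum_comp (Function.Involutive.toPerm (bxor V) (bxor_bxor_cancel V))
      (fun W : Fin (RN M) → Bool => if (hw W : ℝ) < ε * (2 : ℝ) ^ M then 1 else 0)
    simp only [Function.Involutive.coe_toPerm] at h
    rw [Finset.card_filter, Finset.card_filter]
    exact h
  -- the count
  have h4 : (bad.card : ℝ) ≤ (failSetW M D).card * (Real.exp (-(((RN M : ℕ) : ℝ) / 8)) * (2 : ℝ) ^ RN M) := by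
    have hball := card_ball_le hNpos hε
    rw [hN] at hball
    calc (bad.card : ℝ) ≤ ((((failSetW M D).biUnion fun V => univ.filter fun W : Fin (RN M) → Bool =>
          (hw (bxor V W) : ℝ) < ε * (2 : ℝ) ^ M).card : ℕ) : ℝ) := by
          exact_mod_cast Finset.card_le_card h2
      _ ≤ ((∑ V ∈ failSetW M D, (univ.filter fun W : Fin (RN M) → Bool =>
          (hw (bxor V W) : ℝ) < ε * (2 : ℝ) ^ M).card : ℕ) : ℝ) := by
          exact_mod_cast Finset.card_biUnion_le
      _ = (failSetW M D).card * (((univ.filter fun W : Fin (RN M) → Bool =>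
          (hw W : ℝ) < ε * (2 : ℝ) ^ M).card : ℕ) : ℝ) := by
          rw [Finset.sum_congr rfl fun V _ => h3 V, Finset.sum_const, smul_eq_mul]; push_cast; ring
      _ ≤ (failSetW M D).card * (Real.exp (-(((RN M : ℕ) : ℝ) / 8)) * (2 : ℝ) ^ RN M) := by
          refine mul_le_mul_of_nonneg_left ?_ (Nat.cast_nonneg _)
          rw [hN]; exact hball
  have h5 : ((failSetW M D).card : ℝ) ≤ (4 : ℝ) ^ monoCount M D := by
    exact_mod_cast card_failSetW_le M D
  rw [h1, div_le_iff₀ h2N]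
  calc (bad.card : ℝ) ≤ (failSetW M D).card * (Real.exp (-(((RN M : ℕ) : ℝ) / 8)) * (2 : ℝ) ^ RN M) := h4
    _ ≤ (4 : ℝ) ^ monoCount M D * (Real.exp (-(((RN M : ℕ) : ℝ) / 8)) * (2 : ℝ) ^ RN M) :=
        mul_le_mul_of_nonneg_right h5 (by positivity)
    _ = (4 : ℝ) ^ monoCount M D * Real.exp (-(((RN M : ℕ) : ℝ) / 8)) * (2 : ℝ) ^ RN M := by ring

/-- The far tail is eventually small (`M₀` depends on `D`): `4^{ι(M,D)}·e^{−2^M/8} ≤ γ`. -/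
theorem far_eventually (D : ℕ) {γ : ℝ} (hγ : 0 < γ) :
    ∃ M₀ : ℕ, ∀ M : ℕ, M₀ ≤ M → (4 : ℝ) ^ monoCount M D * Real.exp (-(((RN M : ℕ) : ℝ) / 8)) ≤ γ := by
  have hlog4 : 0 < Real.log 4 := Real.log_pos (by norm_num)
  set ε₀ : ℝ := 1 / (32 * (D + 1) * Real.log 4) with hε₀
  have hε₀pos : 0 < ε₀ := by positivity
  have ht := tendsto_pow_const_div_const_pow_of_one_lt D (one_lt_two : (1 : ℝ) < 2)
  obtain ⟨K₀, hK₀⟩ := Filter.eventually_atTop.1 (ht.eventually_le_const hε₀pos)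
  refine ⟨max K₀ ⌈-(16 * Real.log γ)⌉₊, fun M hM => ?_⟩
  have hK : K₀ ≤ M + 1 := by have := le_max_left K₀ ⌈-(16 * Real.log γ)⌉₊; omega
  have hMγ : -(16 * Real.log γ) ≤ M :=
    le_trans (Nat.le_ceil _) (by exact_mod_cast le_trans (le_max_right _ _) hM)
  have hN : ((RN M : ℕ) : ℝ) = (2 : ℝ) ^ M := RN_real M
  have hMN : (M : ℝ) ≤ (2 : ℝ) ^ M := by exact_mod_cast (Nat.lt_two_pow_self).le
  -- `(M+1)^D ≤ ε₀ · 2^{M+1}`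
  have hpoly : ((M + 1 : ℕ) : ℝ) ^ D ≤ ε₀ * (2 : ℝ) ^ (M + 1) := by
    have h := hK₀ (M + 1) hK
    rwa [div_le_iff₀ (by positivity)] at h
  -- `4^{ι} ≤ exp((D+1)(M+1)^D log 4)`
  have hcount : (4 : ℝ) ^ monoCount M D ≤ Real.exp (((D + 1 : ℕ) : ℝ) * ((M + 1 : ℕ) : ℝ) ^ D * Real.log 4) := by
    have h1 : (4 : ℝ) ^ monoCount M D ≤ (4 : ℝ) ^ ((D + 1) * (M + 1) ^ D) :=
      pow_le_pow_right₀ (by norm_num) (monoCount_le M D)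
    refine le_trans h1 (le_of_eq ?_)
    rw [← Real.rpow_natCast, Real.rpow_def_of_pos (by norm_num : (0 : ℝ) < 4)]
    congr 1; push_cast; ring
  rw [hN]
  calc (4 : ℝ) ^ monoCount M D * Real.exp (-((2 : ℝ) ^ M / 8))
      ≤ Real.exp (((D + 1 : ℕ) : ℝ) * ((M + 1 : ℕ) : ℝ) ^ D * Real.log 4) * Real.exp (-((2 : ℝ) ^ M / 8)) :=
        mul_le_mul_of_nonneg_right hcount (Real.exp_pos _).le
    _ = Real.exp (((D + 1 : ℕ) : ℝ) * ((M + 1 : ℕ) : ℝ) ^ D * Real.log 4 - (2 : ℝ) ^ M / 8) := by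
        rw [← Real.exp_add]; ring_nf
    _ ≤ Real.exp (Real.log γ) := by
        apply Real.exp_le_exp.2
        have hD1 : (0 : ℝ) ≤ ((D + 1 : ℕ) : ℝ) * Real.log 4 := by positivity
        have h1 : ((D + 1 : ℕ) : ℝ) * ((M + 1 : ℕ) : ℝ) ^ D * Real.log 4 ≤
            ((D + 1 : ℕ) : ℝ) * Real.log 4 * (ε₀ * (2 : ℝ) ^ (M + 1)) := by
          nlinarith [mul_le_mul_of_nonneg_left hpoly hD1]
        have h2 : ((D + 1 : ℕ) : ℝ) * Real.log 4 * (ε₀ * (2 : ℝ) ^ (M + 1)) = (2 : ℝ) ^ M / 16 := by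
          rw [hε₀, pow_succ]; push_cast; field_simp; ring
        linarith
    _ = γ := Real.exp_log hγ

/-! ### Viola's error under the degree hypothesis (Sketch10 `L8`, without roots) -/

/-- The odd number of summands used against degree `s`: `s` if odd, else `s + 1`. -/
def oddUp (s : ℕ) : ℕ := if s % 2 = 1 then s else s + 1

/-- `oddUp s` is odd, `s ≤ oddUp s ≤ s + 1`. -/
theorem oddUp_spec (s : ℕ) : oddUp s % 2 = 1 ∧ s ≤ oddUp s ∧ oddUp s ≤ s + 1 ∧ 1 ≤ oddUp s := by
  unfold oddUp; split_ifs with h <;> omega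

/-- **Viola's error is small under the degree hypothesis of `ViolaFence`**:
`16·((1 − δ/d)^{2^{D+1}})^{1/2^{d−1}} = 16(1 − δ/d)^{2^{D+2−d}} ≤ 1/2` for `d = oddUp s`. -/
theorem viola_error_le_half {δ : ℝ} {s D : ℕ} (hδ0 : 0 < δ) (hδ : δ < 1 / 4)
    (hD : s + Nat.clog 2 s + Nat.clog 2 ⌈1 / δ⌉₊ + 8 ≤ D) :
    16 * ((1 - δ / oddUp s) ^ (2 ^ (D + 1))) ^ ((1 : ℝ) / (2 : ℝ) ^ (oddUp s - 1)) ≤ 1 / 2 := by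
  obtain ⟨_, hsd, hds, hd1⟩ := oddUp_spec s
  set d := oddUp s with hd
  set c := ⌈1 / δ⌉₊ with hc
  have hdpos : (0 : ℝ) < d := by exact_mod_cast hd1
  -- the base `x = 1 − δ/d ∈ [0, 1]` and the reduced exponent `K = 2^{D+2−d}`
  set x : ℝ := 1 - δ / d with hx
  have hδd : δ / d ≤ δ := div_le_self hδ0.le (by exact_mod_cast hd1)
  have hx0 : 0 ≤ x := by rw [hx]; linarith
  have hsum : (d - 1) + (D + 2 - d) = D + 1 := by omega
  set K : ℕ := 2 ^ (D + 2 - d) with hK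
  have hsum' : (D + 2 - d) + (d - 1) = D + 1 := by omega
  have hpow : x ^ (2 ^ (D + 1)) = (x ^ K) ^ (2 ^ (d - 1)) := by
    rw [← pow_mul, hK, ← pow_add, hsum']
  have hroot : (x ^ (2 ^ (D + 1))) ^ ((1 : ℝ) / (2 : ℝ) ^ (d - 1)) = x ^ K := by
    rw [hpow, show (1 : ℝ) / (2 : ℝ) ^ (d - 1) = (((2 ^ (d - 1) : ℕ) : ℝ))⁻¹ by push_cast; rw [one_div]]
    exact Real.pow_rpow_inv_natCast (pow_nonneg hx0 K) (by positivity)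
  rw [hroot]
  -- `K·δ/d ≥ 16`
  have hKnat : 16 * d * c ≤ K := by
    have h1 : s ≤ 2 ^ Nat.clog 2 s := Nat.le_pow_clog one_lt_two s
    have h2 : c ≤ 2 ^ Nat.clog 2 c := Nat.le_pow_clog one_lt_two c
    have h3 : 2 ^ (9 + Nat.clog 2 s + Nat.clog 2 c) ≤ K :=
      Nat.pow_le_pow_right (by norm_num) (by omega)
    have h4 : 2 ^ (9 + Nat.clog 2 s + Nat.clog 2 c) = 512 * 2 ^ Nat.clog 2 s * 2 ^ Nat.clog 2 c := by
      rw [pow_add, pow_add]; norm_num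
    rw [h4] at h3
    have h5 : d ≤ 2 * 2 ^ Nat.clog 2 s := by
      rcases Nat.eq_zero_or_pos s with hs0 | hs0
      · rw [hs0, Nat.clog_zero_right, pow_zero]; omega
      · omega
    calc 16 * d * c ≤ 16 * (2 * 2 ^ Nat.clog 2 s) * 2 ^ Nat.clog 2 c :=
          Nat.mul_le_mul (Nat.mul_le_mul_left 16 h5) h2
      _ ≤ 512 * 2 ^ Nat.clog 2 s * 2 ^ Nat.clog 2 c := by nlinarith [Nat.one_le_two_pow (n := Nat.clog 2 c), Nat.one_le_two_pow (n := Nat.clog 2 s)]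
      _ ≤ K := h3
  have hcδ : 1 ≤ (c : ℝ) * δ := by
    have : 1 / δ ≤ (c : ℝ) := Nat.le_ceil _
    rw [div_le_iff₀ hδ0] at this; linarith
  have hKx : 16 ≤ (K : ℝ) * (δ / d) := by
    have h : (16 : ℝ) * d * c ≤ K := by exact_mod_cast hKnat
    rw [show (K : ℝ) * (δ / d) = (K : ℝ) * δ / d by ring, le_div_iff₀ hdpos]
    nlinarith [hcδ, hdpos]
  -- `x^K ≤ exp(−Kδ/d) ≤ 1/32`
  have hxexp : x ≤ Real.exp (-(δ / d)) := by
    have := Real.add_one_le_exp (-(δ / d)); rw [hx]; linarith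
  have hxK : x ^ K ≤ Real.exp (-((K : ℝ) * (δ / d))) := by
    calc x ^ K ≤ (Real.exp (-(δ / d))) ^ K := pow_le_pow_left₀ hx0 hxexp K
      _ = Real.exp (-((K : ℝ) * (δ / d))) := by rw [← Real.exp_nat_mul]; ring_nf
  have hexp : Real.exp (-((K : ℝ) * (δ / d))) ≤ 1 / 32 := by
    rw [Real.exp_neg, one_div]
    apply inv_anti₀ (by norm_num)
    have hq := Real.quadratic_le_exp_of_nonneg (show (0 : ℝ) ≤ (K : ℝ) * (δ / d) by linarith)
    nlinarith
  linarith

/-! ### The fence -/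

/-- **FENCE F9-V — `ViolaXorLemma → ViolaFence`** (planner qa-qnc0-p2 ROUND-9 §4, Sketch9p2/Sketch10; proved
along the chain of the module docstring). -/
theorem violaFence_of_violaXor (hV : ViolaXorLemma) : ViolaFence := by
  classical
  intro δ ε η hδ0 hδ4 hε0 hε4 hη0 hη4 s D hD
  obtain ⟨hdodd, hsd, hds, hd1⟩ := oddUp_spec s
  set d := oddUp s with hd
  have hdpos : (0 : ℝ) < d := by exact_mod_cast hd1
  -- the noise rates
  set p : ℝ := δ / (2 * d) with hp
  have h12p : 1 - 2 * p = 1 - δ / d := by rw [hp]; field_simp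
  have hδd : δ / d ≤ δ := div_le_self hδ0.le (by exact_mod_cast hd1)
  have hp0 : 0 ≤ p := by positivity
  have hp1 : p ≤ 1 := by
    have : p = (δ / d) / 2 := by rw [hp]; ring
    rw [this]; linarith
  have hb0 : 0 ≤ 1 - 2 * p := by rw [h12p]; linarith
  have hb1 : 1 - 2 * p ≤ 1 := by linarith
  set q : ℝ := (1 - (1 - 2 * p) ^ d) / 2 with hq
  have hq0 : 0 ≤ q := by
    have : (1 - 2 * p) ^ d ≤ 1 := pow_le_one₀ hb0 hb1
    rw [hq]; linarith
  have hqδ : q ≤ δ / 2 := by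
    have hbern : 1 - δ ≤ (1 - δ / d) ^ d := by
      have h := one_add_mul_le_pow (show (-2 : ℝ) ≤ -(δ / d) by linarith) d
      have hdd : (d : ℝ) * (δ / d) = δ := by field_simp
      calc 1 - δ = 1 + (d : ℝ) * -(δ / d) := by rw [mul_neg, hdd]; ring
        _ ≤ (1 + -(δ / d)) ^ d := h
        _ = (1 - δ / d) ^ d := by rw [← sub_eq_add_neg]
    rw [hq, h12p]
    linarith
  have hq1 : q ≤ 1 := by linarith
  -- the small-bias parameter
  set ε' : ℝ := (1 - 2 * p) ^ (2 ^ (D + 1)) with hε'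
  have hε'0 : 0 ≤ ε' := pow_nonneg hb0 _
  have hε'1 : ε' ≤ 1 := pow_le_one₀ hb0 hb1
  -- the horizon
  obtain ⟨M₁, hM₁⟩ := close_eventually hδ0 (show (0 : ℝ) < 1 / 8 by norm_num)
  obtain ⟨M₂, hM₂⟩ := far_eventually D (show (0 : ℝ) < 1 / 8 by norm_num)
  refine ⟨max M₁ M₂, fun M hM hcert => ?_⟩
  set S := failSetW M D with hS
  set Y : Distr (RN M) := xorConv (unifOn S) (ber (RN M) p) with hY
  have hSne : S.Nonempty := failSetW_nonempty M D
  have hYd : IsDistr Y := isDistr_xorConv (isDistr_unifOn hSne) (isDistr_ber hp0 hp1)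
  -- `Y` is `ε'`-biased: dual distance + damping
  have hYb : EpsBiased Y ε' := by
    intro a ha
    rw [hY, parityBias_xorConv, parityBias_ber]
    by_cases hwa : hw a < 2 ^ (D + 1)
    · rw [hS, parityBias_failSetW_eq_zero ha hwa, zero_mul, abs_zero]; exact hε'0
    · push Not at hwa
      rw [abs_mul, abs_of_nonneg (pow_nonneg hb0 _)]
      have hbias : |parityBias (unifOn S) a| ≤ 1 := by
        rcases parityBias_unifOn_trichotomy hSne (failSetW_tripleClosed M D) a with h | h | h <;>
          rw [h] <;> norm_num
      calc |parityBias (unifOn S) a| * (1 - 2 * p) ^ hw a ≤ 1 * (1 - 2 * p) ^ (2 ^ (D + 1)) :=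
            mul_le_mul hbias (pow_le_pow_of_le_one hb0 hb1 hwa) (pow_nonneg hb0 _) zero_le_one
        _ = ε' := one_mul _
  -- the `d` copies and their fold
  have hlen : (List.replicate d Y).length = d := List.length_replicate
  have hall : ∀ μ ∈ List.replicate d Y, IsDistr μ ∧ EpsBiased μ ε' := by
    intro μ hμ; rw [List.eq_of_mem_replicate hμ]; exact ⟨hYd, hYb⟩
  have hfold : xorFold (List.replicate d Y) = xorConv (unifOn S) (ber (RN M) q) :=
    foldLaw hSne (failSetW_tripleClosed M D) hdodd p
  -- the two tails at this `M`
  have hclose : massNotClose M D δ (xorConv (unifOn S) (ber (RN M) q)) ≤ 1 / 8 :=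
    le_trans (massNotClose_le hδ0.le hq0 hq1) (hM₁ M (le_trans (le_max_left _ _) hM) q hq0 hqδ)
  have hfar : massNotFar M D ε (unifDistr (RN M)) ≤ 1 / 8 :=
    le_trans (massNotFar_le hε4.le) (hM₂ M (le_trans (le_max_right _ _) hM))
  -- a member of the certificate separating the two distributions
  obtain ⟨Φ, hΦdeg, hgap⟩ := averaging (isDistr_xorConv (isDistr_unifOn hSne) (isDistr_ber hq0 hq1))
    isDistr_unifDistr hη0.le hcert hclose hfar
  -- Viola's theorem for that member (degree `s ≤ d`)
  have hdegd : (fun x => if (fun W : Fin (RN M) → Bool => Φ (toRow W)) x then (1 : ZMod 2) else 0) ∈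
      lowDeg (ZMod 2) (RN M) d := lowDeg_mono hsd hΦdeg
  have hviola := hV (RN M) d hd1 ε' hε'0 hε'1 (List.replicate d Y) hlen hall (fun W => Φ (toRow W)) hdegd
  rw [hfold] at hviola
  have harith : 16 * ε' ^ ((1 : ℝ) / (2 : ℝ) ^ (d - 1)) ≤ 1 / 2 := by
    rw [hε', h12p]; exact viola_error_le_half hδ0 hδ4 hD
  have hup := (abs_le.1 (le_trans hviola harith)).2
  linarith

end CubeDistr

/-- FENCE F9-V by its Sketch9p2 name: `ViolaFenceOfLemma := ViolaXorLemma → ViolaFence` holds. -/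
theorem violaFenceOfLemma : Literature.Computability.Complexity.SmallBiasXor.ViolaXorLemma → ViolaFence :=
  CubeDistr.violaFence_of_violaXor

/-- **FENCE F9-V, UNCONDITIONAL**: with qn-lit g13's kernel proof of Viola 2009 Thm 2
(`SmallBiasXor.ViolaXorLemma_holds`), there is no row certificate of degree `s` below
`D − ⌈log₂ s⌉ − ⌈log₂⌈1/δ⌉⌉ − 8` — the lower edge of the (parked) certificate paradigm for α is a theorem. -/
theorem violaFence : ViolaFence :=
  CubeDistr.violaFence_of_violaXor Literature.Computability.Complexity.SmallBiasXor.ViolaXorLemma_holds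

end Summit.QuantumAdvantage.AdviceFreeQNC0
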